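import Summits.Ventures.PercRepro.ProfileTwoAverage
import Summits.Ventures.PercRepro.C025ProfileAll
import Summits.Ventures.PercRepro.ChooseThreeBound

/-!
# PercRepro — THE ROW `q = 3` OF (Π): THE «LINE PLUS A POINT» SETS ARE PAID BY THE ROW `q = 1` OF THE CONTRACTIONS
(p10, gen 5; `proofs/P10-Q3-INDEP.md` §6, piece (P3))

A rank-3 set with exactly one coloop is `B = L ⊔ {p}`, `L` a rank-2 set with `≥ 3` points (its non-coloops) and
`p ∉ cl L`.  Its price `C(ρ(E∖B), u−3) / C(u,3)` is at most the row-`(1, u−2)` price of the singleton `{p}` in the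
contraction `N = M / L` — `C(r′+1, u−2) / (r′+1)` with `r′ = ρ_N(E_N ∖ p) = ρ(E ∖ p) − 2 ≥ ρ(E∖B) − 2` — because
`(u−2)·C(r, u−3) ≤ C(u,3)·C(r−2, u−3)` for `r ≥ u ≥ 3`.  The row `q = 1` of (Π) for `N` (tree:
`profileIneq_one_all`, every finite matroid) bounds the sum of these prices by the number of rank-`(u−2)` sets of
`N`.  Summing over `L`: the demand of the line-plus-point sets is at most `C(u,3)` times
`Σ_{L fat rank-2} #{X ⊆ E ∖ L : ρ(X ∪ L) = u}`.

* `fat3lp` — the rank-3 sets with exactly one coloop;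
* `choose_le_choose_three_mul_choose_two` — `(u−2)·C(r, u−3) ≤ C(u,3)·C(r−2, u−3)`;
* **`fat3lp_demand_le`** — the bound.
-/

open scoped Matroid

namespace PercRepro.Cogirth

open Finset ThmH Skew Shadow Profile

variable {α : Type} [DecidableEq α] {M : Matroid α} [M.Finite] {u : ℕ}

open Classical in
/-- The rank-3 subsets of the ground set with exactly one coloop (a fat rank-2 set plus a point). -/
noncomputable def fat3lp (M : Matroid α) [M.Finite] : Finset (Finset α) :=
  (Rq M 3).filter (fun B => (coloops M B).card = 1)

open Classical in
/-- Membership in `fat3lp`. -/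
theorem mem_fat3lp {B : Finset α} : B ∈ fat3lp M ↔ B ∈ Rq M 3 ∧ (coloops M B).card = 1 := by
  unfold fat3lp
  rw [mem_filter]

/-- `C(r, k) · (r−k)(r−k−1) = C(r−2, k) · r(r−1)` for `k + 2 ≤ r`. -/
theorem choose_mul_two_factors {r k : ℕ} (h : k + 2 ≤ r) :
    r.choose k * ((r - k) * (r - k - 1)) = (r - 2).choose k * (r * (r - 1)) := by
  obtain ⟨m, rfl⟩ : ∃ m, r = m + 2 := ⟨r - 2, by omega⟩
  have e1 := Nat.choose_mul_succ_eq (m + 1) k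
  have e2 := Nat.choose_mul_succ_eq m k
  rw [show m + 2 - 2 = m by omega, show m + 2 - k - 1 = m + 1 - k by omega, show m + 2 - 1 = m + 1 by omega]
  rw [show m + 1 + 1 = m + 2 by omega] at e1
  calc (m + 2).choose k * ((m + 2 - k) * (m + 1 - k))
      = ((m + 2).choose k * (m + 2 - k)) * (m + 1 - k) := by ring
    _ = ((m + 1).choose k * (m + 2)) * (m + 1 - k) := by rw [← e1]
    _ = ((m + 1).choose k * (m + 1 - k)) * (m + 2) := by ring
    _ = (m.choose k * (m + 1)) * (m + 2) := by rw [← e2]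
    _ = m.choose k * ((m + 2) * (m + 1)) := by ring

/-- `6 · r(r−1) ≤ u(u−1) · (r−u+3)(r−u+2)` for `3 ≤ u ≤ r` (factor by factor). -/
theorem six_mul_le_of_three_le_two {u t : ℕ} (hu : 3 ≤ u) :
    6 * ((u + t) * (u + t - 1)) ≤ u * (u - 1) * ((t + 3) * (t + 2)) := by
  obtain ⟨v, rfl⟩ : ∃ v, u = v + 3 := ⟨u - 3, by omega⟩
  rw [show v + 3 + t - 1 = v + t + 2 by omega, show v + 3 - 1 = v + 2 by omega]
  have h1 : 3 * (v + 3 + t) ≤ (v + 3) * (t + 3) := by nlinarith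
  have h2 : 2 * (v + t + 2) ≤ (v + 2) * (t + 2) := by nlinarith
  calc 6 * ((v + 3 + t) * (v + t + 2)) = (3 * (v + 3 + t)) * (2 * (v + t + 2)) := by ring
    _ ≤ ((v + 3) * (t + 3)) * ((v + 2) * (t + 2)) := Nat.mul_le_mul h1 h2
    _ = (v + 3) * (v + 2) * ((t + 3) * (t + 2)) := by ring

/-- **`(u−2) · C(r, u−3) ≤ C(u,3) · C(r−2, u−3)`** for `3 ≤ u ≤ r`: the price of a line-plus-point set is at most
the row-`(1, u−2)` price of the point in the contraction by the line. -/
theorem choose_le_choose_three_mul_choose_two {u r : ℕ} (hu : 3 ≤ u) (hur : u ≤ r) :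
    (u - 2) * r.choose (u - 3) ≤ u.choose 3 * (r - 2).choose (u - 3) := by
  obtain ⟨t, rfl⟩ : ∃ t, r = u + t := ⟨r - u, by omega⟩
  have hid := choose_mul_two_factors (r := u + t) (k := u - 3) (by omega)
  rw [show u + t - (u - 3) = t + 3 by omega, show t + 3 - 1 = t + 2 by omega] at hid
  have h6 := choose_three_mul_six u
  have hpoly := six_mul_le_of_three_le_two (u := u) (t := t) hu
  have key : (u - 2) * (u + t).choose (u - 3) * (6 * ((t + 3) * (t + 2))) ≤
      u.choose 3 * (u + t - 2).choose (u - 3) * (6 * ((t + 3) * (t + 2))) := by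
    calc (u - 2) * (u + t).choose (u - 3) * (6 * ((t + 3) * (t + 2)))
        = (u - 2) * 6 * ((u + t).choose (u - 3) * ((t + 3) * (t + 2))) := by ring
      _ = (u - 2) * 6 * ((u + t - 2).choose (u - 3) * ((u + t) * (u + t - 1))) := by rw [hid]
      _ = (u - 2) * (u + t - 2).choose (u - 3) * (6 * ((u + t) * (u + t - 1))) := by ring
      _ ≤ (u - 2) * (u + t - 2).choose (u - 3) * (u * (u - 1) * ((t + 3) * (t + 2))) :=
          Nat.mul_le_mul_left _ hpoly
      _ = (u + t - 2).choose (u - 3) * ((u * (u - 1) * (u - 2)) * ((t + 3) * (t + 2))) := by ring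
      _ = (u + t - 2).choose (u - 3) * ((u.choose 3 * 6) * ((t + 3) * (t + 2))) := by rw [h6]
      _ = u.choose 3 * (u + t - 2).choose (u - 3) * (6 * ((t + 3) * (t + 2))) := by ring
  exact Nat.le_of_mul_le_mul_right key (by positivity)


omit [DecidableEq α] in
/-- The closure of a subset of the ground set lies in the ground set. -/
theorem clF_subset_gr' (L : Finset α) : clF M L ⊆ gr M := by
  intro y hy
  have h1 : y ∈ M.closure (L : Set α) := by rw [← coe_clF]; exact_mod_cast hy
  have h2 : y ∈ M.E := M.closure_subset_ground _ h1
  rw [← coe_gr] at h2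
  exact_mod_cast h2

omit [DecidableEq α] in
/-- `ρ(cl L) = ρ(L)`. -/
theorem rk_clF_eq (L : Finset α) : rk M (clF M L) = rk M L := by
  unfold rk
  congr 1
  rw [coe_clF]
  exact M.eRk_closure_eq _

omit [DecidableEq α] in
/-- A point off `cl L` is off `cl (cl L)`. -/
theorem notMem_clF_clF {L : Finset α} {p : α} (hp : p ∉ clF M L) : p ∉ clF M (clF M L) := by
  intro h
  apply hp
  have h1 : p ∈ M.closure ((clF M L : Finset α) : Set α) := by rw [← coe_clF]; exact_mod_cast h
  rw [coe_clF, M.closure_closure] at h1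
  rw [← Finset.mem_coe, coe_clF]
  exact h1

/-! ### The per-line bound through the row `q = 1` of the contraction -/

/-- The candidate points of a fat rank-2 set `L`: the ground elements off `L` and off its closure. -/
noncomputable def extPts (M : Matroid α) [M.Finite] (L : Finset α) : Finset α :=
  (gr M \ L).filter (fun p => p ∉ clF M L)

/-- For `L ⊆ E` of rank `2` and `p ∈ extPts M L`: the rank of `gr N ∖ {p}` in `N = M / L` is `ρ(E ∖ p) − 2`,
and `ρ(E ∖ (L ∪ p)) ≤ ρ(E ∖ p)`. -/
theorem rk_contract_sdiff_singleton {L : Finset α} (hrL : rk M L = 2) {p : α} (hp : p ∈ extPts M L) :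
    rk (M ／ (clF M L : Set α)) (gr (M ／ (clF M L : Set α)) \ {p}) + 2 = rk M ((gr M).erase p) := by
  unfold extPts at hp
  rw [mem_filter, mem_sdiff] at hp
  have hLg : clF M L ⊆ gr M := clF_subset_gr' L
  rw [gr_contract_finset]
  have hX : (gr M \ clF M L) \ {p} ⊆ gr M \ clF M L := sdiff_subset
  have h := rk_contract_add_rk hLg hX
  rw [rk_clF_eq, hrL] at h
  have heq : ((gr M \ clF M L) \ {p}) ∪ clF M L = (gr M).erase p := by
    ext x
    simp only [mem_union, mem_sdiff, mem_singleton, mem_erase]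
    constructor
    · rintro (⟨⟨hx, _⟩, hxp⟩ | hx)
      · exact ⟨hxp, hx⟩
      · exact ⟨fun hxp => hp.2 (hxp ▸ hx), hLg hx⟩
    · rintro ⟨hxp, hx⟩
      by_cases hxL : x ∈ clF M L
      · exact Or.inr hxL
      · exact Or.inl ⟨⟨hx, hxL⟩, hxp⟩
  rw [heq] at h
  exact h

/-- A candidate point is a rank-1 set of the contraction. -/
theorem singleton_mem_Rq_contract {L : Finset α} (hrL : rk M L = 2) {p : α} (hp : p ∈ extPts M L) :
    ({p} : Finset α) ∈ Rq (M ／ (clF M L : Set α)) 1 := by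
  unfold extPts at hp
  rw [mem_filter, mem_sdiff] at hp
  have hLg : clF M L ⊆ gr M := clF_subset_gr' L
  have hpc : p ∈ gr M \ clF M L := mem_sdiff.2 ⟨hp.1.1, hp.2⟩
  rw [mem_Rq, gr_contract_finset]
  refine ⟨singleton_subset_iff.2 hpc, ?_⟩
  have h := rk_contract_add_rk hLg (X := {p}) (singleton_subset_iff.2 hpc)
  rw [rk_clF_eq, hrL] at h
  have hins : rk M ({p} ∪ clF M L) = 3 := by
    rw [singleton_union, rk_insert_eq (M := M) hp.1.1 hLg, if_neg (notMem_clF_clF hp.2), rk_clF_eq, hrL]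
  rw [hins] at h
  rw [← coe_rk]
  exact_mod_cast (by omega : rk (M ／ (clF M L : Set α)) {p} = 1)

/-- **The price comparison**: for `L` of rank `2` and a candidate point `p`, the demand of `L ∪ {p}` is at most
`C(u,3)` times the row-`(1, u−2)` price of `{p}` in `M / L`. -/
theorem demand_insert_le_price_contract (hu : 3 ≤ u) {L : Finset α} (hrL : rk M L = 2)
    {p : α} (hp : p ∈ extPts M L) :
    (demand M 3 u (insert p L) : ℚ) ≤ u.choose 3 * price (M ／ (clF M L : Set α)) 1 (u - 2) {p} := by
  -- the rank `r′` of `gr N ∖ {p}` in `N`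
  have hr' := rk_contract_sdiff_singleton hrL hp
  obtain ⟨r', hr'eq⟩ : ∃ r', rk (M ／ (clF M L : Set α)) (gr (M ／ (clF M L : Set α)) \ {p}) = r' := ⟨_, rfl⟩
  rw [hr'eq] at hr'
  -- the demand side: `r := ρ(E ∖ (L ∪ p)) ≤ ρ(E ∖ p) = r′ + 2`
  have hsub : gr M \ insert p L ⊆ (gr M).erase p := by
    intro x hx
    rw [mem_sdiff, mem_insert, not_or] at hx
    exact mem_erase.2 ⟨hx.2.1, hx.1⟩
  have hrle : rk M (gr M \ insert p L) ≤ r' + 2 := by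
    rw [hr']
    exact rk_mono' hsub
  unfold demand price
  rw [← coe_rk (M := M ／ (clF M L : Set α)) (gr (M ／ (clF M L : Set α)) \ {p}), hr'eq]
  simp only [ENat.toNat_coe, Nat.cast_le, Nat.choose_one_right]
  split_ifs with h1 h2 h2
  · -- both prices positive: `(r′+1) · C(r, u−3) ≤ C(u,3) · C(r′+1, u−2)`
    rw [show u - 2 = (u - 3) + 1 by omega] at h2 ⊢
    have hkey : (r' + 1) * (rk M (gr M \ insert p L)).choose (u - 3) ≤
        u.choose 3 * (r' + 1).choose (u - 3 + 1) := by
      have hA := choose_le_choose_three_mul_choose_two hu h1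
      have hB : (rk M (gr M \ insert p L) - 2).choose (u - 3) ≤ r'.choose (u - 3) :=
        Nat.choose_le_choose _ (by omega)
      have hC := Nat.add_one_mul_choose_eq r' (u - 3)
      -- `(r′+1) · C(r′, u−3) = C(r′+1, u−2) · (u−2)`
      have hpos : 0 < u - 2 := by omega
      refine Nat.le_of_mul_le_mul_right ?_ hpos
      calc (r' + 1) * (rk M (gr M \ insert p L)).choose (u - 3) * (u - 2)
          = (r' + 1) * ((u - 2) * (rk M (gr M \ insert p L)).choose (u - 3)) := by ring
        _ ≤ (r' + 1) * (u.choose 3 * (rk M (gr M \ insert p L) - 2).choose (u - 3)) :=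
            Nat.mul_le_mul_left _ hA
        _ ≤ (r' + 1) * (u.choose 3 * r'.choose (u - 3)) := Nat.mul_le_mul_left _ (Nat.mul_le_mul_left _ hB)
        _ = u.choose 3 * ((r' + 1) * r'.choose (u - 3)) := by ring
        _ = u.choose 3 * ((r' + 1).choose (u - 3 + 1) * (u - 3 + 1)) := by rw [← hC]
        _ = u.choose 3 * (r' + 1).choose (u - 3 + 1) * (u - 2) := by
            rw [show u - 3 + 1 = u - 2 by omega]; ring
    have hr1 : (0 : ℚ) < ((r' + 1 : ℕ) : ℚ) := by positivity
    rw [← mul_div_assoc, le_div_iff₀ hr1]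
    have hkey' : (rk M (gr M \ insert p L)).choose (u - 3) * (r' + 1) ≤
        u.choose 3 * (r' + 1).choose (u - 3 + 1) := by rw [mul_comm]; exact hkey
    exact_mod_cast hkey'
  · -- `u ≤ r` but the contraction price vanishes: impossible, `r ≤ r′ + 2`
    exfalso
    apply h2
    have : (u - 2 : ℕ) ≤ r' := by omega
    exact_mod_cast this
  · -- the demand vanishes
    rw [Nat.cast_zero]
    exact mul_nonneg (Nat.cast_nonneg _) (div_nonneg (Nat.cast_nonneg _) (Nat.cast_nonneg _))
  · rw [Nat.cast_zero, mul_zero]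

/-- **The per-line bound**: the demand of the extensions `L ∪ {p}` of a rank-2 set `L` is at most `C(u,3)` times
the number of rank-`(u−2)` sets of `M / L` — the row `q = 1` of (Π) for the contraction (`profileIneq_one_all`). -/
theorem sum_demand_extPts_le (hu : 3 ≤ u) {L : Finset α} (hrL : rk M L = 2) :
    ∑ p ∈ extPts M L, demand M 3 u (insert p L) ≤
      u.choose 3 * (levelSet (M ／ (clF M L : Set α)) (u - 2)).card := by
  have hrow := profileIneq_one_all (M ／ (clF M L : Set α)) (u - 2) (by omega)
  unfold ProfileIneq at hrow
  have h1 : ∑ p ∈ extPts M L, (demand M 3 u (insert p L) : ℚ) ≤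
      u.choose 3 * ∑ p ∈ extPts M L, price (M ／ (clF M L : Set α)) 1 (u - 2) {p} := by
    rw [mul_sum]
    exact sum_le_sum (fun p hp => demand_insert_le_price_contract hu hrL hp)
  have himg : ∑ p ∈ extPts M L, price (M ／ (clF M L : Set α)) 1 (u - 2) {p} =
      ∑ Y ∈ (extPts M L).image (fun p => ({p} : Finset α)), price (M ／ (clF M L : Set α)) 1 (u - 2) Y :=
    (sum_image (fun x _ y _ h => singleton_inj.1 h)).symm
  have h2 : ∑ Y ∈ (extPts M L).image (fun p => ({p} : Finset α)), price (M ／ (clF M L : Set α)) 1 (u - 2) Y ≤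
      ∑ Y ∈ Rq (M ／ (clF M L : Set α)) 1, price (M ／ (clF M L : Set α)) 1 (u - 2) Y := by
    apply sum_le_sum_of_subset_of_nonneg
    · intro Y hY
      rw [mem_image] at hY
      obtain ⟨p, hp, rfl⟩ := hY
      exact singleton_mem_Rq_contract hrL hp
    · intro Y _ _
      exact price_nonneg _ _ _
  have hQ : ∑ p ∈ extPts M L, (demand M 3 u (insert p L) : ℚ) ≤
      (u.choose 3 : ℚ) * ((levelSet (M ／ (clF M L : Set α)) (u - 2)).card : ℚ) := by
    calc ∑ p ∈ extPts M L, (demand M 3 u (insert p L) : ℚ)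
        ≤ u.choose 3 * ∑ p ∈ extPts M L, price (M ／ (clF M L : Set α)) 1 (u - 2) {p} := h1
      _ ≤ u.choose 3 * ∑ Y ∈ Rq (M ／ (clF M L : Set α)) 1, price (M ／ (clF M L : Set α)) 1 (u - 2) Y := by
          rw [himg]
          exact mul_le_mul_of_nonneg_left h2 (Nat.cast_nonneg _)
      _ ≤ u.choose 3 * ((levelSet (M ／ (clF M L : Set α)) (u - 2)).card : ℚ) :=
          mul_le_mul_of_nonneg_left hrow (Nat.cast_nonneg _)
  exact_mod_cast hQ

/-- A rank-3 set with exactly one coloop `c` is `insert c L` with `L = B ∖ {c}` a fat rank-2 set and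
`c ∈ extPts M L`. -/
theorem exists_fat2_extPts_of_mem_fat3lp {B : Finset α} (hB : B ∈ fat3lp M) :
    ∃ L ∈ fat2 M, ∃ p ∈ extPts M L, insert p L = B := by
  rw [mem_fat3lp] at hB
  obtain ⟨hB3, hc⟩ := hB
  have hBg : B ⊆ gr M := (mem_Rq.1 hB3).1
  have hrB : rk M B = 3 := rk_eq_of_mem_Rq hB3
  obtain ⟨c, hceq⟩ := card_eq_one.1 hc
  have hcB : c ∈ B := (mem_coloops.1 (by rw [hceq]; exact mem_singleton_self c)).1
  have hcl : c ∉ clF M (B.erase c) := (mem_coloops.1 (by rw [hceq]; exact mem_singleton_self c)).2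
  have hrL : rk M (B.erase c) = 2 := by
    have h := rk_erase_of_mem_coloops hBg (z := c) (by rw [hceq]; exact mem_singleton_self c)
    omega
  have hLg : B.erase c ⊆ gr M := (erase_subset c B).trans hBg
  refine ⟨B.erase c, ?_, c, ?_, insert_erase hcB⟩
  · rw [mem_fat2]
    refine ⟨mem_Rq.2 ⟨hLg, by rw [← coe_rk, hrL]⟩, fun hind => ?_⟩
    -- an independent set of rank `2` has two elements, but `B ∖ c` has `≥ 3`
    have h1 := rk_eq_card_of_indep hind
    rw [hrL] at h1
    -- `B` has at least four elements: rank 3 with a non-coloop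
    have hB4 : 4 ≤ B.card := by
      by_contra hlt
      have hle : B.card ≤ 3 := by omega
      have hle' : rk M B ≤ B.card := rk_le_card B
      have hBc : B.card = 3 := by omega
      have hBi : M.Indep (B : Set α) := indep_of_rk_eq_card (by omega)
      -- then every element is a coloop: `#coloops = 3 ≠ 1`
      have hall : ∀ z ∈ B, z ∈ coloops M B := by
        intro z hz
        rw [mem_coloops]
        refine ⟨hz, fun hzcl => ?_⟩
        have h := rk_insert_eq (M := M) (hBg hz) (X := B.erase z) ((erase_subset z B).trans hBg)
        rw [insert_erase hz, if_pos hzcl, hrB] at h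
        have h2 : rk M (B.erase z) ≤ (B.erase z).card := rk_le_card _
        rw [card_erase_of_mem hz, hBc] at h2
        omega
      have : B ⊆ coloops M B := hall
      have := card_le_card this
      omega
    have := card_erase_of_mem hcB
    omega
  · unfold extPts
    rw [mem_filter, mem_sdiff]
    exact ⟨⟨hBg hcB, notMem_erase c B⟩, hcl⟩

/-- **The line-plus-point sets are paid by the rows `q = 1` of the contractions by the fat rank-2 sets**:
`Σ_{B ∈ fat3lp} d_B ≤ C(u,3) · Σ_{L ∈ fat2} #{rank-(u−2) sets of M / cl L}` on every finite matroid, `u ≥ 3` —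
the right side counts the pairs `(S, ℓ)` with `S` of rank `u` and `ℓ` a line meeting `S` in `≥ 3` points. -/
theorem fat3lp_demand_le (hu : 3 ≤ u) :
    ∑ B ∈ fat3lp M, demand M 3 u B ≤
      u.choose 3 * ∑ L ∈ fat2 M, (levelSet (M ／ (clF M L : Set α)) (u - 2)).card := by
  classical
  set σ := (fat2 M).sigma (fun L => extPts M L) with hσ
  have hsub : fat3lp M ⊆ σ.image (fun x : Σ _ : Finset α, α => insert x.2 x.1) := by
    intro B hB
    obtain ⟨L, hL, p, hp, hpL⟩ := exists_fat2_extPts_of_mem_fat3lp hB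
    rw [mem_image]
    exact ⟨⟨L, p⟩, mem_sigma.2 ⟨hL, hp⟩, hpL⟩
  calc ∑ B ∈ fat3lp M, demand M 3 u B
      ≤ ∑ B ∈ σ.image (fun x : Σ _ : Finset α, α => insert x.2 x.1), demand M 3 u B :=
        sum_le_sum_of_subset_of_nonneg hsub (fun _ _ _ => Nat.zero_le _)
    _ ≤ ∑ x ∈ σ, demand M 3 u (insert x.2 x.1) :=
        sum_image_le_of_nonneg (fun _ _ => Nat.zero_le _)
    _ = ∑ L ∈ fat2 M, ∑ p ∈ extPts M L, demand M 3 u (insert p L) := by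
        rw [hσ, sum_sigma]
    _ ≤ ∑ L ∈ fat2 M, u.choose 3 * (levelSet (M ／ (clF M L : Set α)) (u - 2)).card := by
        apply sum_le_sum
        intro L hL
        exact sum_demand_extPts_le hu (rk_eq_of_mem_Rq (mem_fat2.1 hL).1)
    _ = u.choose 3 * ∑ L ∈ fat2 M, (levelSet (M ／ (clF M L : Set α)) (u - 2)).card := by rw [mul_sum]

end PercRepro.Cogirth
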